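import Summits.QuantumAdvantage.QuantumAdvantage.Theorems.LinnikCubicClassGroupsDegreeOnePrimesEscapeQuarticS4Count
import Literature.NumberTheory.GaloisRepresentations.DegreeOnePrimesFixedField
import Mathlib.Algebra.Group.Conj
import HarnessLib

/-!
# Frobenius classes at unramified primes: bookkeeping for conjugation-invariant sets

Topic `Summits/QuantumAdvantage/QuantumAdvantage/Theorems`, cell B2b-1 (linnik-cubic), PART A (gen 14);
helper toward the crux `DegreeOnePrimesEscape` (stmt-QuantumAdvantage-11543) of route
`LinnikCubicClassGroups`.  HONEST FRAMING: the value of this file is a THEOREM (kernel-checked algebra and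
Dedekind–Frobenius bookkeeping) — NOT summit progress.

The prime number theorems `frobeniusClass_PNT_all` / `frobeniusClass_PNT_pi_all` of this cell count the
primes `p ∤ d_N` by the predicate "some prime `Q ∣ p` of `N` with trivial inertia has a Frobenius `φ`
with `gφg⁻¹ = σ`".  To sum them over the classes of a conjugation-invariant set `S ⊆ Gal(N/ℚ)` (and, later,
over the classes with a given coset cycle type = splitting type) one needs:

* `isConj_of_isArithFrobAt` — at a prime `p` whose primes in `N` have trivial inertia, the Frobenius
  elements of any two primes `Q, Q' ∣ p` are conjugate (the primes above `p` are conjugate, Mathlib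
  `Ideal.exists_smul_eq_of_isGaloisGroup`; Frobenius is unique when the inertia group is trivial);
* `classPred_iff_isConj`, `subsetPred_iff_mem` — with a fixed Frobenius datum `(Q₀, φ₀)` at `p`, the
  class predicate of `σ` holds iff `IsConj φ₀ σ`, and the predicate "`φ ∈ S` for some Frobenius `φ`
  at `p`" holds iff `φ₀ ∈ S`;
* `sum_natCard_mk_eq` — `Σ_{C ⊆ S} |C| = |S|` over the conjugacy classes of a conjugation-invariant `S`;
* `card_filter_subsetPred_eq_sum` — `#{p ≤ m : p ∤ d_N, Frob_p ∈ S} = Σ_{C ⊆ S} #{p ≤ m : p ∤ d_N,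
  Frob_p ∈ C}`.

References: J. Neukirch, *Algebraic Number Theory*, I §9 [NeukirchANT1999];
J. C. Lagarias, H. L. Montgomery, A. M. Odlyzko, Invent. Math. 54 (1979) [LagariasMontgomeryOdlyzko1979].
-/

noncomputable section

open scoped NumberField nonZeroDivisors Pointwise
open Finset Ideal NumberField
open Literature.NumberTheory.NumberFields Literature.NumberTheory.GaloisRepresentations

namespace Summit.QuantumAdvantage.QuantumAdvantage.Theorems.DegreeOnePrimesEscape

/-! ### Group theory: classes of a conjugation-invariant set -/

section Group

variable {G : Type*} [Group G]

/-- A conjugation-invariant set contains the conjugacy class of each of its elements. -/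
theorem mem_of_isConj_of_conjInvariant {S : Set G} (hS : ∀ g h : G, g ∈ S → h * g * h⁻¹ ∈ S)
    {a b : G} (ha : a ∈ S) (hab : IsConj a b) : b ∈ S := by
  obtain ⟨c, hc⟩ := isConj_iff.mp hab
  rw [← hc]
  exact hS a c ha

/-- The intersection of a conjugation-invariant set with a normal subgroup is conjugation-invariant. -/
theorem conjInvariant_inter_of_normal {S : Set G} (hS : ∀ g h : G, g ∈ S → h * g * h⁻¹ ∈ S)
    (K : Subgroup G) [hK : K.Normal] :
    ∀ g h : G, g ∈ {x : G | x ∈ S ∧ x ∈ K} → h * g * h⁻¹ ∈ {x : G | x ∈ S ∧ x ∈ K} :=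
  fun g h hg => ⟨hS g h hg.1, hK.conj_mem g hg.2 h⟩

/-- The part of a conjugation-invariant set outside a normal subgroup is conjugation-invariant. -/
theorem conjInvariant_diff_of_normal {S : Set G} (hS : ∀ g h : G, g ∈ S → h * g * h⁻¹ ∈ S)
    (K : Subgroup G) [hK : K.Normal] :
    ∀ g h : G, g ∈ {x : G | x ∈ S ∧ x ∉ K} → h * g * h⁻¹ ∈ {x : G | x ∈ S ∧ x ∉ K} := by
  intro g h hg
  refine ⟨hS g h hg.1, fun hmem => hg.2 ?_⟩
  have := hK.conj_mem _ hmem h⁻¹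
  simpa [mul_assoc] using this

/-- `|{τ : IsConj σ τ}| = |{τ : mk τ = C}|` when `mk σ = C`. -/
theorem natCard_isConj_eq_natCard_mk_eq {σ : G} {C : ConjClasses G} (h : ConjClasses.mk σ = C) :
    Nat.card {τ : G // IsConj σ τ} = Nat.card {τ : G // ConjClasses.mk τ = C} := by
  refine Nat.card_congr (Equiv.subtypeEquivRight fun τ => ?_)
  rw [← h, ConjClasses.mk_eq_mk_iff_isConj]
  exact ⟨fun h1 => h1.symm, fun h1 => h1.symm⟩

open scoped Classical in
/-- **`Σ_{C ⊆ S} |C| = |S|`**: the classes of a conjugation-invariant set `S` of a finite group partition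
`S`. -/
theorem sum_natCard_mk_eq [Fintype G] {S : Set G} (hS : ∀ g h : G, g ∈ S → h * g * h⁻¹ ∈ S) :
    ∑ C ∈ (Finset.univ.filter fun g : G => g ∈ S).image ConjClasses.mk,
        Nat.card {τ : G // ConjClasses.mk τ = C} = Nat.card S := by
  have h1 : Nat.card S = (Finset.univ.filter fun g : G => g ∈ S).card := by
    rw [Nat.card_eq_fintype_card, ← Fintype.card_subtype]
  rw [h1, Finset.card_eq_sum_card_image ConjClasses.mk]
  refine Finset.sum_congr rfl fun C hC => ?_
  obtain ⟨s, hs, hsC⟩ := Finset.mem_image.mp hC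
  rw [Finset.mem_filter] at hs
  rw [Nat.card_eq_fintype_card, Fintype.card_subtype]
  congr 1
  ext τ
  simp only [Finset.mem_filter, Finset.mem_univ, true_and]
  constructor
  · intro hτ
    refine ⟨?_, hτ⟩
    rw [← hsC, ConjClasses.mk_eq_mk_iff_isConj] at hτ
    exact mem_of_isConj_of_conjInvariant hS hs.2 hτ.symm
  · exact fun h => h.2

end Group

/-! ### Frobenius classes at a prime with trivial inertia -/

section Field

variable {N : Type} [Field N] [NumberField N] [IsGalois ℚ N]

/-- **Frobenius elements at the primes above an unramified `p` are conjugate**: if `Q, Q' ∣ p` are primes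
of the Galois number field `N`, `φ` is an arithmetic Frobenius at `Q` with `I(Q) = 1`, and `φ'` is an
arithmetic Frobenius at `Q'`, then `φ' = gφg⁻¹` for some `g`. [cite: NeukirchANT1999, Ch. I §9 (9.4)–(9.6)] -/
theorem isConj_of_isArithFrobAt {p : ℕ} {Q Q' : Ideal (𝓞 N)} (hQ : Q.IsMaximal)
    (hQp : Q.LiesOver (span {(p : ℤ)})) (hQ' : Q'.IsMaximal) (hQ'p : Q'.LiesOver (span {(p : ℤ)}))
    {φ φ' : N ≃ₐ[ℚ] N} (hφ : IsArithFrobAt ℤ φ Q) (hI : Q.inertia (N ≃ₐ[ℚ] N) = ⊥)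
    (hφ' : IsArithFrobAt ℤ φ' Q') : IsConj φ φ' := by
  haveI := hQ
  haveI := hQp
  haveI := hQ'
  haveI := hQ'p
  haveI : IsGaloisGroup (N ≃ₐ[ℚ] N) ℤ (𝓞 N) := IsGaloisGroup.of_isFractionRing _ _ _ ℚ N
  obtain ⟨g, hg⟩ := Ideal.exists_smul_eq_of_isGaloisGroup (span {(p : ℤ)}) Q Q' (N ≃ₐ[ℚ] N)
  have h1 : IsArithFrobAt ℤ (g * φ * g⁻¹) Q' := hg ▸ hφ.conj g
  have hI' : Q'.inertia (N ≃ₐ[ℚ] N) = ⊥ := hg ▸ DegreeOnePrimes.inertia_smul_eq_bot hI g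
  have h2 : g * φ * g⁻¹ = φ' := DegreeOnePrimes.isArithFrobAt_unique h1 hφ' hI'
  exact isConj_iff.mpr ⟨g, h2⟩

/-- **The class predicate is `IsConj φ₀ σ`.**  Fix a prime `Q₀ ∣ p` with trivial inertia and Frobenius
`φ₀`.  Then "some prime `Q ∣ p` with trivial inertia has a Frobenius `φ` with `gφg⁻¹ = σ`" holds iff
`σ` is conjugate to `φ₀`. -/
theorem classPred_iff_isConj {p : ℕ} {Q₀ : Ideal (𝓞 N)} (hQ₀ : Q₀.IsMaximal)
    (hQ₀p : Q₀.LiesOver (span {(p : ℤ)})) {φ₀ : N ≃ₐ[ℚ] N} (hφ₀ : IsArithFrobAt ℤ φ₀ Q₀)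
    (hI₀ : Q₀.inertia (N ≃ₐ[ℚ] N) = ⊥) (σ : N ≃ₐ[ℚ] N) :
    (∃ (Q : Ideal (𝓞 N)) (_ : Q.IsMaximal) (_ : Q.LiesOver (span {(p : ℤ)})) (φ g : N ≃ₐ[ℚ] N),
        IsArithFrobAt ℤ φ Q ∧ Q.inertia (N ≃ₐ[ℚ] N) = ⊥ ∧ g * φ * g⁻¹ = σ) ↔ IsConj φ₀ σ := by
  constructor
  · rintro ⟨Q, hQ, hQp, φ, g, hφ, -, hg⟩
    have h1 : IsConj φ₀ φ := isConj_of_isArithFrobAt hQ₀ hQ₀p hQ hQp hφ₀ hI₀ hφ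
    exact h1.trans (isConj_iff.mpr ⟨g, hg⟩)
  · intro h
    obtain ⟨g, hg⟩ := isConj_iff.mp h
    exact ⟨Q₀, hQ₀, hQ₀p, φ₀, g, hφ₀, hI₀, hg⟩

/-- **The subset predicate is `φ₀ ∈ S`** for a conjugation-invariant `S`: with `(Q₀, φ₀)` as above,
"some prime `Q ∣ p` with trivial inertia has a Frobenius in `S`" holds iff `φ₀ ∈ S`. -/
theorem subsetPred_iff_mem {p : ℕ} {Q₀ : Ideal (𝓞 N)} (hQ₀ : Q₀.IsMaximal)
    (hQ₀p : Q₀.LiesOver (span {(p : ℤ)})) {φ₀ : N ≃ₐ[ℚ] N} (hφ₀ : IsArithFrobAt ℤ φ₀ Q₀)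
    (hI₀ : Q₀.inertia (N ≃ₐ[ℚ] N) = ⊥) {S : Set (N ≃ₐ[ℚ] N)}
    (hS : ∀ g h : N ≃ₐ[ℚ] N, g ∈ S → h * g * h⁻¹ ∈ S) :
    (∃ (Q : Ideal (𝓞 N)) (_ : Q.IsMaximal) (_ : Q.LiesOver (span {(p : ℤ)})) (φ : N ≃ₐ[ℚ] N),
        IsArithFrobAt ℤ φ Q ∧ Q.inertia (N ≃ₐ[ℚ] N) = ⊥ ∧ φ ∈ S) ↔ φ₀ ∈ S := by
  constructor
  · rintro ⟨Q, hQ, hQp, φ, hφ, -, hφS⟩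
    have h1 : IsConj φ₀ φ := isConj_of_isArithFrobAt hQ₀ hQ₀p hQ hQp hφ₀ hI₀ hφ
    exact mem_of_isConj_of_conjInvariant hS hφS h1.symm
  · intro h
    exact ⟨Q₀, hQ₀, hQ₀p, φ₀, hφ₀, hI₀, h⟩

/-- **A Frobenius class function at the unramified primes.**  For every prime `p ∤ d_N` there is
`φ₀ ∈ Gal(N/ℚ)` (a Frobenius at a prime above `p` with trivial inertia) such that the class predicate of
`σ` at `p` is `IsConj φ₀ σ` and the subset predicate of every conjugation-invariant `S` is `φ₀ ∈ S`. -/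
theorem exists_frobRep {p : ℕ} (hp : p.Prime) (hpN : ¬ ((p : ℤ) ∣ NumberField.discr N)) :
    ∃ φ₀ : N ≃ₐ[ℚ] N,
      (∀ σ : N ≃ₐ[ℚ] N,
        (∃ (Q : Ideal (𝓞 N)) (_ : Q.IsMaximal) (_ : Q.LiesOver (span {(p : ℤ)})) (φ g : N ≃ₐ[ℚ] N),
          IsArithFrobAt ℤ φ Q ∧ Q.inertia (N ≃ₐ[ℚ] N) = ⊥ ∧ g * φ * g⁻¹ = σ) ↔ IsConj φ₀ σ) ∧
      (∀ S : Set (N ≃ₐ[ℚ] N), (∀ g h : N ≃ₐ[ℚ] N, g ∈ S → h * g * h⁻¹ ∈ S) →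
        ((∃ (Q : Ideal (𝓞 N)) (_ : Q.IsMaximal) (_ : Q.LiesOver (span {(p : ℤ)})) (φ : N ≃ₐ[ℚ] N),
          IsArithFrobAt ℤ φ Q ∧ Q.inertia (N ≃ₐ[ℚ] N) = ⊥ ∧ φ ∈ S) ↔ φ₀ ∈ S)) := by
  obtain ⟨Q₀, hQ₀, hQ₀p, ⟨φ₀, hφ₀⟩, hI₀⟩ := exists_isArithFrobAt_of_not_dvd_discr (N := N) hp hpN
  exact ⟨φ₀, fun σ => classPred_iff_isConj hQ₀ hQ₀p hφ₀ hI₀ σ,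
    fun S hS => subsetPred_iff_mem hQ₀ hQ₀p hφ₀ hI₀ hS⟩

open scoped Classical in
/-- **`#{p ≤ m : p ∤ d_N, Frob_p ∈ S} = Σ_{C ⊆ S} #{p ≤ m : p ∤ d_N, Frob_p ∈ C}`** for a
conjugation-invariant `S`, the classes `C` of `S` being listed as `mk` of the elements of `S` and
represented by any `rep C` with `mk (rep C) = C`. -/
theorem card_filter_subsetPred_eq_sum {S : Set (N ≃ₐ[ℚ] N)}
    (hS : ∀ g h : N ≃ₐ[ℚ] N, g ∈ S → h * g * h⁻¹ ∈ S)
    (rep : ConjClasses (N ≃ₐ[ℚ] N) → (N ≃ₐ[ℚ] N))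
    (hrep : ∀ C ∈ (Finset.univ.filter fun g : N ≃ₐ[ℚ] N => g ∈ S).image ConjClasses.mk,
      ConjClasses.mk (rep C) = C) (m : ℕ) :
    ((Nat.primesLE m).filter (fun p : ℕ => ¬ ((p : ℤ) ∣ NumberField.discr N) ∧
        ∃ (Q : Ideal (𝓞 N)) (_ : Q.IsMaximal) (_ : Q.LiesOver (span {(p : ℤ)})) (φ : N ≃ₐ[ℚ] N),
          IsArithFrobAt ℤ φ Q ∧ Q.inertia (N ≃ₐ[ℚ] N) = ⊥ ∧ φ ∈ S)).card =
      ∑ C ∈ (Finset.univ.filter fun g : N ≃ₐ[ℚ] N => g ∈ S).image ConjClasses.mk,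
        ((Nat.primesLE m).filter (fun p : ℕ => ¬ ((p : ℤ) ∣ NumberField.discr N) ∧
          ∃ (Q : Ideal (𝓞 N)) (_ : Q.IsMaximal) (_ : Q.LiesOver (span {(p : ℤ)})) (φ g : N ≃ₐ[ℚ] N),
            IsArithFrobAt ℤ φ Q ∧ Q.inertia (N ≃ₐ[ℚ] N) = ⊥ ∧ g * φ * g⁻¹ = rep C)).card := by
  -- a Frobenius class function at the primes `p ∤ d_N`
  have key : ∀ p : ℕ, p.Prime → ¬ ((p : ℤ) ∣ NumberField.discr N) → ∃ φ₀ : N ≃ₐ[ℚ] N,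
      (∀ σ : N ≃ₐ[ℚ] N,
        (∃ (Q : Ideal (𝓞 N)) (_ : Q.IsMaximal) (_ : Q.LiesOver (span {(p : ℤ)})) (φ g : N ≃ₐ[ℚ] N),
          IsArithFrobAt ℤ φ Q ∧ Q.inertia (N ≃ₐ[ℚ] N) = ⊥ ∧ g * φ * g⁻¹ = σ) ↔ IsConj φ₀ σ) ∧
      ((∃ (Q : Ideal (𝓞 N)) (_ : Q.IsMaximal) (_ : Q.LiesOver (span {(p : ℤ)})) (φ : N ≃ₐ[ℚ] N),
          IsArithFrobAt ℤ φ Q ∧ Q.inertia (N ≃ₐ[ℚ] N) = ⊥ ∧ φ ∈ S) ↔ φ₀ ∈ S) := by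
    intro p hp hpN
    obtain ⟨φ₀, h1, h2⟩ := exists_frobRep (N := N) hp hpN
    exact ⟨φ₀, h1, h2 S hS⟩
  choose! Φ hΦc hΦS using key
  set R := (Finset.univ.filter fun g : N ≃ₐ[ℚ] N => g ∈ S).image ConjClasses.mk with hR
  -- rewrite the left count through `Φ`
  set s := (Nat.primesLE m).filter (fun p : ℕ => ¬ ((p : ℤ) ∣ NumberField.discr N) ∧ Φ p ∈ S)
    with hs
  have hL : ((Nat.primesLE m).filter (fun p : ℕ => ¬ ((p : ℤ) ∣ NumberField.discr N) ∧
      ∃ (Q : Ideal (𝓞 N)) (_ : Q.IsMaximal) (_ : Q.LiesOver (span {(p : ℤ)})) (φ : N ≃ₐ[ℚ] N),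
        IsArithFrobAt ℤ φ Q ∧ Q.inertia (N ≃ₐ[ℚ] N) = ⊥ ∧ φ ∈ S)) = s := by
    rw [hs]
    refine Finset.filter_congr fun p hp => ?_
    have hp' := (Nat.mem_primesLE.mp hp).2
    constructor
    · rintro ⟨hpN, h⟩; exact ⟨hpN, (hΦS p hp' hpN).mp h⟩
    · rintro ⟨hpN, h⟩; exact ⟨hpN, (hΦS p hp' hpN).mpr h⟩
  rw [hL]
  -- fibres of `p ↦ mk (Φ p)` over `R`
  have hmaps : (s : Set ℕ).MapsTo (fun p : ℕ => ConjClasses.mk (Φ p)) R := by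
    intro p hp
    have hp' := Finset.mem_filter.mp (Finset.mem_coe.mp hp)
    rw [hR, Finset.coe_image]
    exact ⟨Φ p, Finset.mem_coe.mpr (Finset.mem_filter.mpr ⟨Finset.mem_univ _, hp'.2.2⟩), rfl⟩
  rw [Finset.card_eq_sum_card_fiberwise hmaps]
  refine Finset.sum_congr rfl fun C hC => ?_
  have hrepC := hrep C hC
  obtain ⟨s₀, hs₀, hs₀C⟩ := Finset.mem_image.mp hC
  rw [Finset.mem_filter] at hs₀
  rw [hs, Finset.filter_filter]
  congr 1
  refine Finset.filter_congr fun p hp => ?_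
  have hp' := (Nat.mem_primesLE.mp hp).2
  constructor
  · rintro ⟨⟨hpN, -⟩, hC'⟩
    refine ⟨hpN, (hΦc p hp' hpN (rep C)).mpr ?_⟩
    rw [← ConjClasses.mk_eq_mk_iff_isConj, hC', hrepC]
  · rintro ⟨hpN, h⟩
    have h1 : IsConj (Φ p) (rep C) := (hΦc p hp' hpN (rep C)).mp h
    have h2 : ConjClasses.mk (Φ p) = C := by
      rw [← hrepC, ConjClasses.mk_eq_mk_iff_isConj]; exact h1
    refine ⟨⟨hpN, ?_⟩, h2⟩
    have h3 : IsConj s₀ (Φ p) := by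
      rw [← ConjClasses.mk_eq_mk_iff_isConj, hs₀C, h2]
    exact mem_of_isConj_of_conjInvariant hS hs₀.2 h3

end Field

end Summit.QuantumAdvantage.QuantumAdvantage.Theorems.DegreeOnePrimesEscape

end
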